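import Summits.CriticalPhenomena.PercolationContinuityZ3.Theorems.SahiBoxTP2CellFKG
import Summits.CriticalPhenomena.PercolationContinuityZ3.Theorems.SahiBoxTP2WeakLimits

/-!
# Box-TP₂ is preserved by continuous log-supermodular tilts

Support file of the Sahi cell (`prim-sahi`, typer seat, generation 14; `--supports stmt-CriticalPhenomena-4575`).
Theorems only (no definitions, no named facts, no sorries).

For DENSITIES, "the product of two MTP₂ functions is MTP₂" is a triviality; for MEASURES it is not even a
statement, and the cell's intrinsic notion `IsBoxTP2` (TP₂ on closed boxes, = cell-FKG on every grid =
Milgrom–Weber affiliation; generations 11–12) is what replaces it.  This file proves the closure of box-TP₂ laws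
on the cube `Q_d = (Fin d → [0,1])` under tilting:

* `IsBoxTP2.withDensity_of_continuous` — if `μ` is a finite box-TP₂ measure on `Q_d` (possibly singular) and
  `ρ : Q_d → ℝ≥0` is CONTINUOUS and log-supermodular (`ρ x · ρ y ≤ ρ (x ⊓ y) · ρ (x ⊔ y)`), then `ρ · μ` is box-TP₂;
* `IsBoxTP2.withDensity_exp_of_submodular` — in particular the Gibbs modification `e^{−H} · μ` for a continuous
  submodular `H` (ferromagnetic / attractive interaction) of ANY box-TP₂ reference law is box-TP₂ — hence FKG and,
  given `C_n`, Sahi-positive of every order (`SahiBoxTP2Positivity.lean`).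

Proof.  (1) `isBoxTP2_of_frequently_latticeCondition`: the FKG lattice condition for the cell weights at a
COFINAL set of grid levels already gives box-TP₂ (generation 11's cell-hull argument along a subsequence; no
normalisation needed).  (2) Nested grids (`cellIdx_coarse`: the level-`((m+1)k−1)` cell determines the level-`m`
cell, `⌊(m+1)k·x⌋ / k = ⌊(m+1)x⌋`): the step density `ρ_m = ρ ∘ (lower corner of the level-m cell)` is
log-supermodular (corners and cells commute with `⊓, ⊔`) and constant on the cells of every level `(m+1)k − 1`, so
the cell weights of `ρ_m · μ` there are `ρ_m(corner) · μ(cell)` — a product of a log-supermodular function and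
weights with the lattice condition (`IsBoxTP2.cubeCellWeight_latticeCondition`) — whence `ρ_m · μ` is box-TP₂
(`isBoxTP2_withDensity_step`).  (3) `ρ_m → ρ` pointwise (continuity; the corner is within `1/(m+1)`), boundedly
(compactness), so `(ρ_m μ)(B) → (ρ μ)(B)` for every Borel `B` (dominated convergence), and box-TP₂ passes to the
limit by the abstract closure lemma `IsBoxTP2.of_limsup_liminf` of `SahiBoxTP2WeakLimits.lean` with trivial outer
boxes.

No sorries, no new axioms.
-/

noncomputable section

namespace Summit.CriticalPhenomena.PercolationContinuityZ3.Theorems.SahiBoxTP2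

open MeasureTheory Set Filter Topology Function Literature.Combinatorics.Sahi2008
open Literature.Combinatorics.Sahi2008.LebesgueSquare (gridPt cellIdx)
open Literature.Combinatorics.Sahi2008.LebesgueCube (cubeCell measurable_cubeCell cubeCell_mono loCube_cubeCell_le
  le_hiCube_cubeCell)
open Summit.CriticalPhenomena.PercolationContinuityZ3.Theorems.SahiCubeDensity (cubeCellWeight cubeCellWeight_nonneg
  cubeCell_inf cubeCell_sup)
open scoped ENNReal NNReal unitInterval

variable {d m : ℕ}

/-! ### The lattice condition for cell weights at a cofinal set of levels gives box-TP₂ -/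

/-- **Four functions on the grid** for weights with the FKG lattice condition (no normalisation):
`w[p,q] w[p',q'] ≤ w[p∧p', q∧q'] w[p∨p', q∨q']` for boxes of cells. [folklore] -/
theorem sum_Icc_mul_sum_Icc_le_of_latticeCondition {w : (Fin d → Fin (m + 1)) → ℝ} (hw0 : ∀ c, 0 ≤ w c)
    (hw : ∀ a b, w a * w b ≤ w (a ⊓ b) * w (a ⊔ b)) (p q p' q' : Fin d → Fin (m + 1)) :
    (∑ c ∈ Finset.Icc p q, w c) * (∑ c ∈ Finset.Icc p' q', w c) ≤
      (∑ c ∈ Finset.Icc (p ⊓ p') (q ⊓ q'), w c) * (∑ c ∈ Finset.Icc (p ⊔ p') (q ⊔ q'), w c) := by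
  classical
  have h4 := four_functions_theorem w w w w hw0 hw0 hw0 hw0 hw (Finset.Icc p q) (Finset.Icc p' q')
  refine h4.trans (mul_le_mul ?_ ?_ (Finset.sum_nonneg fun c _ => hw0 c) (Finset.sum_nonneg fun c _ => hw0 c))
  · refine Finset.sum_le_sum_of_subset_of_nonneg (fun c hc => ?_) fun c _ _ => hw0 c
    obtain ⟨a, ha, b, hb, rfl⟩ := Finset.mem_infs.1 hc
    rw [Finset.mem_Icc] at ha hb ⊢
    exact ⟨inf_le_inf ha.1 hb.1, inf_le_inf ha.2 hb.2⟩
  · refine Finset.sum_le_sum_of_subset_of_nonneg (fun c hc => ?_) fun c _ _ => hw0 c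
    obtain ⟨a, ha, b, hb, rfl⟩ := Finset.mem_sups.1 hc
    rw [Finset.mem_Icc] at ha hb ⊢
    exact ⟨sup_le_sup ha.1 hb.1, sup_le_sup ha.2 hb.2⟩

/-- The cell-hull inequality at one grid level, for a finite measure whose cell weights at that level satisfy the
FKG lattice condition. [this work] -/
theorem measure_cellHull_mul_le_of_latticeCondition (μ : Measure (Fin d → I)) [IsFiniteMeasure μ]
    (hw : ∀ a b, cubeCellWeight μ m a * cubeCellWeight μ m b ≤
      cubeCellWeight μ m (a ⊓ b) * cubeCellWeight μ m (a ⊔ b)) (a b a' b' : Fin d → I) :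
    μ (cellHull m a b) * μ (cellHull m a' b') ≤
      μ (cellHull m (a ⊓ a') (b ⊓ b')) * μ (cellHull m (a ⊔ a') (b ⊔ b')) := by
  have key := sum_Icc_mul_sum_Icc_le_of_latticeCondition (fun c => cubeCellWeight_nonneg μ c) hw (cubeCell m a)
    (cubeCell m b) (cubeCell m a') (cubeCell m b')
  rw [← measureReal_cubeCell_preimage, ← measureReal_cubeCell_preimage, ← measureReal_cubeCell_preimage,
    ← measureReal_cubeCell_preimage, ← cubeCell_inf, ← cubeCell_inf, ← cubeCell_sup, ← cubeCell_sup] at key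
  simp only [measureReal_def] at key
  rw [← ENNReal.toReal_mul, ← ENNReal.toReal_mul,
    ENNReal.toReal_le_toReal (ENNReal.mul_ne_top (measure_ne_top _ _) (measure_ne_top _ _))
      (ENNReal.mul_ne_top (measure_ne_top _ _) (measure_ne_top _ _))] at key
  exact key

/-- **The FKG lattice condition for the cell weights at a cofinal set of grid levels implies box-TP₂** (finite
measures; the cell hulls of the four boxes converge along the subsequence). [this work] -/
theorem isBoxTP2_of_frequently_latticeCondition (μ : Measure (Fin d → I)) [IsFiniteMeasure μ]
    (h : ∃ᶠ m in atTop, ∀ a b, cubeCellWeight μ m a * cubeCellWeight μ m b ≤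
      cubeCellWeight μ m (a ⊓ b) * cubeCellWeight μ m (a ⊔ b)) :
    IsBoxTP2 μ := by
  obtain ⟨φ, hφ, hP⟩ := extraction_of_frequently_atTop h
  intro a b a' b'
  exact le_of_tendsto_of_tendsto'
    (ENNReal.Tendsto.mul ((tendsto_measure_cellHull μ a b).comp hφ.tendsto_atTop) (Or.inr (measure_ne_top _ _))
      ((tendsto_measure_cellHull μ a' b').comp hφ.tendsto_atTop) (Or.inr (measure_ne_top _ _)))
    (ENNReal.Tendsto.mul ((tendsto_measure_cellHull μ _ _).comp hφ.tendsto_atTop) (Or.inr (measure_ne_top _ _))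
      ((tendsto_measure_cellHull μ _ _).comp hφ.tendsto_atTop) (Or.inr (measure_ne_top _ _)))
    fun k => measure_cellHull_mul_le_of_latticeCondition μ (hP k) a b a' b'

/-- **Box-TP₂ finite measures satisfy the FKG lattice condition for their cell weights** (the unnormalised content
of generation 11's `IsBoxTP2.isFKGMeasure_cubeCellWeight`). [this work] -/
theorem IsBoxTP2.cubeCellWeight_latticeCondition (μ : Measure (Fin d → I)) [IsFiniteMeasure μ] (hμ : IsBoxTP2 μ)
    (m : ℕ) (c c' : Fin d → Fin (m + 1)) :
    cubeCellWeight μ m c * cubeCellWeight μ m c' ≤ cubeCellWeight μ m (c ⊓ c') * cubeCellWeight μ m (c ⊔ c') := by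
  have key : μ (cubeCell m ⁻¹' {c}) * μ (cubeCell m ⁻¹' {c'}) ≤
      μ (cubeCell m ⁻¹' {c ⊓ c'}) * μ (cubeCell m ⁻¹' {c ⊔ c'}) := by
    rw [cubeCell_preimage_singleton_eq_iUnion, cubeCell_preimage_singleton_eq_iUnion,
      cubeCell_preimage_singleton_eq_iUnion, cubeCell_preimage_singleton_eq_iUnion]
    refine measure_mul_le_of_monotone_iUnion μ (monotone_cellBox c) (monotone_cellBox c')
      (monotone_cellBox _) (monotone_cellBox _) fun k => ?_
    have h := hμ (cellLoCorner m c) (cellHiCorner m k c) (cellLoCorner m c') (cellHiCorner m k c')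
    rwa [← cellLoCorner_inf, ← cellHiCorner_inf, ← cellLoCorner_sup, ← cellHiCorner_sup] at h
  simp only [cubeCellWeight, measureReal_def]
  rw [← ENNReal.toReal_mul, ← ENNReal.toReal_mul]
  exact ENNReal.toReal_mono (ENNReal.mul_ne_top (measure_ne_top _ _) (measure_ne_top _ _)) key

/-! ### Nested grids: the level-`((m+1)k − 1)` cell determines the level-`m` cell -/

/-- `((m+1)k − 1) + 1 = (m+1)k` for `k ≥ 1`. [folklore] -/
theorem fineLevel_succ (m : ℕ) {k : ℕ} (hk : 0 < k) : (m + 1) * k - 1 + 1 = (m + 1) * k :=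
  Nat.sub_add_cancel (Nat.one_le_iff_ne_zero.2 (Nat.mul_ne_zero (Nat.succ_ne_zero m) hk.ne'))

/-- `((m+1)k − 1) / k = m` for `k ≥ 1`. [folklore] -/
theorem fineLevel_div (m : ℕ) {k : ℕ} (hk : 0 < k) : ((m + 1) * k - 1) / k = m := by
  have h : (m + 1) * k - 1 = (k - 1) + m * k := by
    have : (m + 1) * k = m * k + k := by ring
    omega
  rw [h, Nat.add_mul_div_right _ _ hk, Nat.div_eq_of_lt (Nat.sub_lt hk Nat.one_pos), zero_add]

/-- **Nested grids on `[0,1]`**: the index of the level-`m` cell of `x` is the index of its level-`((m+1)k−1)` cell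
divided by `k` (`⌊(m+1)k·x⌋ / k = ⌊(m+1)x⌋`, with the closed last cells matching). [folklore] -/
theorem cellIdx_coarse (x : I) (m : ℕ) {k : ℕ} (hk : 0 < k) :
    (cellIdx m x : ℕ) = (cellIdx ((m + 1) * k - 1) x : ℕ) / k := by
  have e1 : (cellIdx m x : ℕ) = min ⌊((m : ℝ) + 1) * x⌋₊ m := rfl
  have e2 : (cellIdx ((m + 1) * k - 1) x : ℕ) =
      min ⌊((((m + 1) * k - 1 : ℕ) : ℝ) + 1) * x⌋₊ ((m + 1) * k - 1) := rfl
  have hcast : ((((m + 1) * k - 1 : ℕ) : ℝ) + 1) = ((m : ℝ) + 1) * k := by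
    have h := congrArg (Nat.cast (R := ℝ)) (fineLevel_succ m hk)
    push_cast at h
    linarith
  have hk' : (0 : ℝ) < k := by exact_mod_cast hk
  have hfloor : ⌊((m : ℝ) + 1) * k * x⌋₊ / k = ⌊((m : ℝ) + 1) * x⌋₊ := by
    rw [← Nat.floor_div_natCast, mul_assoc, mul_comm (k : ℝ), ← mul_assoc, mul_div_assoc, div_self hk'.ne',
      mul_one]
  rw [e1, e2, hcast]
  set A := ⌊((m : ℝ) + 1) * k * x⌋₊ with hA
  rw [← hfloor]
  rcases le_or_gt A ((m + 1) * k - 1) with hle | hlt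
  · rw [min_eq_left hle, min_eq_left]
    have : A < (m + 1) * k := lt_of_le_of_lt hle (Nat.sub_lt (Nat.mul_pos (Nat.succ_pos m) hk) Nat.one_pos)
    exact Nat.lt_succ_iff.1 ((Nat.div_lt_iff_lt_mul hk).2 this)
  · rw [min_eq_right hlt.le, fineLevel_div m hk, min_eq_right]
    have : (m + 1) * k ≤ A := by omega
    calc m = m * k / k := (Nat.mul_div_cancel m hk).symm
      _ ≤ A / k := Nat.div_le_div_right (by nlinarith)

/-- The level-`((m+1)k−1)` cell of a point of `Q_d` determines its level-`m` cell. [folklore] -/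
theorem cubeCell_eq_of_fine_eq {x y : Fin d → I} (m : ℕ) {k : ℕ} (hk : 0 < k)
    (h : cubeCell ((m + 1) * k - 1) x = cubeCell ((m + 1) * k - 1) y) : cubeCell m x = cubeCell m y := by
  funext j
  apply Fin.ext
  have hx := cellIdx_coarse (x j) m hk
  have hy := cellIdx_coarse (y j) m hk
  have hj := congrFun h j
  change cellIdx ((m + 1) * k - 1) (x j) = cellIdx ((m + 1) * k - 1) (y j) at hj
  change (cellIdx m (x j) : ℕ) = (cellIdx m (y j) : ℕ)
  rw [hx, hy, hj]

/-- Grid points are the lower corners of their own cells: `cellIdx M (i/(M+1)) = i`. [folklore] -/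
theorem cellIdx_gridPt {M : ℕ} (i : Fin (M + 1)) : cellIdx M (gridPt (M + 1) i) = i := by
  apply Fin.ext
  change min ⌊((M : ℝ) + 1) * ((gridPt (M + 1) i : I) : ℝ)⌋₊ M = i
  rw [coe_gridPt_eq_div (Nat.succ_pos M) i.2.le]
  have hM : ((M : ℝ) + 1) ≠ 0 := by positivity
  rw [show ((M + 1 : ℕ) : ℝ) = (M : ℝ) + 1 by push_cast; ring, mul_div_cancel₀ _ hM, Nat.floor_natCast]
  exact min_eq_left (Nat.lt_succ_iff.1 i.2)

/-- The lower corner of a cell lies in that cell. [folklore] -/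
theorem cubeCell_cellLoCorner {M : ℕ} (c : Fin d → Fin (M + 1)) : cubeCell M (cellLoCorner M c) = c :=
  funext fun j => cellIdx_gridPt (c j)

/-! ### The lower corner of the cell of `x` converges to `x` -/

/-- `0 ≤ x_j − (lower corner)_j ≤ 1/(m+1)` coordinatewise. [folklore] -/
theorem sub_cellLoCorner_cubeCell_le (x : Fin d → I) (j : Fin d) :
    0 ≤ (x j : ℝ) - (cellLoCorner m (cubeCell m x) j : ℝ) ∧
      (x j : ℝ) - (cellLoCorner m (cubeCell m x) j : ℝ) ≤ 1 / ((m : ℝ) + 1) := by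
  have hlo : (cellLoCorner m (cubeCell m x) j : ℝ) ≤ x j := loCube_cubeCell_le x j
  have hidx := (cellIdx_eq_iff (x j) (cubeCell m x j)).1 rfl
  set i : Fin (m + 1) := cubeCell m x j with hi
  have hcoe : (cellLoCorner m (cubeCell m x) j : ℝ) = (i : ℝ) / ((m : ℝ) + 1) := by
    change ((gridPt (m + 1) (cubeCell m x j) : I) : ℝ) = _
    rw [coe_gridPt_eq_div (Nat.succ_pos m) (cubeCell m x j).2.le]
    push_cast
    rfl
  refine ⟨by linarith, ?_⟩
  rw [hcoe]
  have hm : (0 : ℝ) < (m : ℝ) + 1 := by positivity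
  by_cases him : (i : ℕ) < m
  · have h2 := hidx.2 him
    rw [add_div] at h2
    linarith
  · have hieq : (i : ℕ) = m := le_antisymm (Nat.lt_succ_iff.1 i.2) (not_lt.1 him)
    have hx1 : (x j : ℝ) ≤ 1 := (x j).2.2
    have : (i : ℝ) / ((m : ℝ) + 1) = 1 - 1 / ((m : ℝ) + 1) := by
      rw [show (i : ℝ) = m by exact_mod_cast hieq]
      field_simp
      ring
    rw [this]
    linarith

/-- **The lower corner of the level-`m` cell of `x` converges to `x`** as `m → ∞`. [folklore] -/
theorem tendsto_cellLoCorner_cubeCell (x : Fin d → I) :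
    Tendsto (fun m : ℕ => cellLoCorner m (cubeCell m x)) atTop (𝓝 x) := by
  rw [tendsto_pi_nhds]
  intro j
  rw [tendsto_subtype_rng]
  have h0 : Tendsto (fun m : ℕ => (x j : ℝ) - 1 / ((m : ℝ) + 1)) atTop (𝓝 (x j : ℝ)) := by
    simpa only [sub_zero] using tendsto_const_nhds.sub tendsto_margin
  refine tendsto_of_tendsto_of_tendsto_of_le_of_le h0 tendsto_const_nhds (fun m => ?_) fun m => ?_
  · have := (sub_cellLoCorner_cubeCell_le (m := m) x j).2
    simp only
    linarith
  · have := (sub_cellLoCorner_cubeCell_le (m := m) x j).1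
    simp only
    linarith

/-! ### The step densities `ρ_m = ρ ∘ (lower corner of the level-m cell)` -/

section Step

variable (ρ : (Fin d → I) → ℝ≥0)

/-- The step density is log-supermodular if `ρ` is (cells and corners commute with `⊓`, `⊔`). [this work] -/
theorem step_latticeCondition (hρ : ∀ x y, ρ x * ρ y ≤ ρ (x ⊓ y) * ρ (x ⊔ y)) (m : ℕ) (x y : Fin d → I) :
    ρ (cellLoCorner m (cubeCell m x)) * ρ (cellLoCorner m (cubeCell m y)) ≤
      ρ (cellLoCorner m (cubeCell m (x ⊓ y))) * ρ (cellLoCorner m (cubeCell m (x ⊔ y))) := by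
  rw [cubeCell_inf, cubeCell_sup, cellLoCorner_inf, cellLoCorner_sup]
  exact hρ _ _

/-- The step density is measurable (it factors through the finite cell index). [folklore] -/
theorem measurable_step (m : ℕ) :
    Measurable fun x : Fin d → I => (ρ (cellLoCorner m (cubeCell m x)) : ℝ≥0∞) :=
  (measurable_of_countable fun c : Fin d → Fin (m + 1) => (ρ (cellLoCorner m c) : ℝ≥0∞)).comp
    (measurable_cubeCell m)

/-- The step density is bounded by its largest corner value. [folklore] -/
theorem step_le_sup (m : ℕ) (x : Fin d → I) :
    (ρ (cellLoCorner m (cubeCell m x)) : ℝ≥0∞) ≤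
      ((Finset.univ.sup fun c : Fin d → Fin (m + 1) => ρ (cellLoCorner m c) : ℝ≥0) : ℝ≥0∞) :=
  ENNReal.coe_le_coe.2 (Finset.le_sup (f := fun c : Fin d → Fin (m + 1) => ρ (cellLoCorner m c))
    (Finset.mem_univ (cubeCell m x)))

/-- A density bounded by a constant gives a finite tilted measure. [folklore] -/
theorem isFiniteMeasure_withDensity_of_le (μ : Measure (Fin d → I)) [IsFiniteMeasure μ] {f : (Fin d → I) → ℝ≥0∞}
    {R : ℝ≥0} (hf : ∀ x, f x ≤ R) : IsFiniteMeasure (μ.withDensity f) := by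
  refine isFiniteMeasure_withDensity (ne_of_lt ?_)
  calc ∫⁻ x, f x ∂μ ≤ ∫⁻ _, (R : ℝ≥0∞) ∂μ := lintegral_mono fun x => hf x
    _ = R * μ univ := lintegral_const _
    _ < ∞ := ENNReal.mul_lt_top ENNReal.coe_lt_top (measure_lt_top _ _)

/-- **The step-tilted measure on the cells of a nested level**: `(ρ_m μ)(cell') = ρ_m(corner of cell') · μ(cell')`
for the cells of level `(m+1)k − 1` (the step density is constant there). [this work] -/
theorem withDensity_step_apply_fineCell (μ : Measure (Fin d → I)) (m : ℕ) {k : ℕ} (hk : 0 < k)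
    (c' : Fin d → Fin ((m + 1) * k - 1 + 1)) :
    μ.withDensity (fun x => (ρ (cellLoCorner m (cubeCell m x)) : ℝ≥0∞)) (cubeCell ((m + 1) * k - 1) ⁻¹' {c'}) =
      (ρ (cellLoCorner m (cubeCell m (cellLoCorner ((m + 1) * k - 1) c'))) : ℝ≥0∞) *
        μ (cubeCell ((m + 1) * k - 1) ⁻¹' {c'}) := by
  rw [withDensity_apply _ (measurableSet_cubeCell_preimage {c'}),
    setLIntegral_congr_fun (measurableSet_cubeCell_preimage {c'})
      (g := fun _ => (ρ (cellLoCorner m (cubeCell m (cellLoCorner ((m + 1) * k - 1) c'))) : ℝ≥0∞)) ?_,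
    setLIntegral_const]
  intro x hx
  have hx' : cubeCell ((m + 1) * k - 1) x = cubeCell ((m + 1) * k - 1) (cellLoCorner ((m + 1) * k - 1) c') := by
    rw [cubeCell_cellLoCorner]; exact hx
  simp only [cubeCell_eq_of_fine_eq m hk hx']

/-- **The step-tilted measure of a box-TP₂ law is box-TP₂**: at every nested level `(m+1)k − 1` its cell weights are
`ρ_m(corner) · μ(cell)`, the product of a log-supermodular function and weights with the lattice condition, and
these levels are cofinal. [this work] -/
theorem isBoxTP2_withDensity_step (μ : Measure (Fin d → I)) [IsFiniteMeasure μ] (hμ : IsBoxTP2 μ)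
    (hρ : ∀ x y, ρ x * ρ y ≤ ρ (x ⊓ y) * ρ (x ⊔ y)) (m : ℕ) :
    IsBoxTP2 (μ.withDensity fun x => (ρ (cellLoCorner m (cubeCell m x)) : ℝ≥0∞)) := by
  haveI := isFiniteMeasure_withDensity_of_le μ (step_le_sup ρ m)
  refine isBoxTP2_of_frequently_latticeCondition _ (frequently_atTop.2 fun N => ⟨(m + 1) * (N + 1) - 1, ?_, ?_⟩)
  · have : N + 1 ≤ (m + 1) * (N + 1) := Nat.le_mul_of_pos_left _ (Nat.succ_pos m)
    omega
  · intro a b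
    have hk : 0 < N + 1 := Nat.succ_pos N
    -- the four cell weights, factored
    have hw : ∀ c : Fin d → Fin ((m + 1) * (N + 1) - 1 + 1),
        cubeCellWeight (μ.withDensity fun x => (ρ (cellLoCorner m (cubeCell m x)) : ℝ≥0∞)) _ c =
          (ρ (cellLoCorner m (cubeCell m (cellLoCorner ((m + 1) * (N + 1) - 1) c))) : ℝ) *
            cubeCellWeight μ _ c := by
      intro c
      simp only [cubeCellWeight, measureReal_def]
      rw [withDensity_step_apply_fineCell ρ μ m hk c, ENNReal.toReal_mul, ENNReal.coe_toReal]
    rw [hw, hw, hw, hw]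
    -- log-supermodularity of the corner values on the fine grid
    have hG : (ρ (cellLoCorner m (cubeCell m (cellLoCorner ((m + 1) * (N + 1) - 1) a))) : ℝ) *
        ρ (cellLoCorner m (cubeCell m (cellLoCorner ((m + 1) * (N + 1) - 1) b))) ≤
        ρ (cellLoCorner m (cubeCell m (cellLoCorner ((m + 1) * (N + 1) - 1) (a ⊓ b)))) *
          ρ (cellLoCorner m (cubeCell m (cellLoCorner ((m + 1) * (N + 1) - 1) (a ⊔ b)))) := by
      have h := step_latticeCondition ρ hρ m (cellLoCorner ((m + 1) * (N + 1) - 1) a)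
        (cellLoCorner ((m + 1) * (N + 1) - 1) b)
      rw [← cellLoCorner_inf, ← cellLoCorner_sup] at h
      exact_mod_cast h
    have hwμ := hμ.cubeCellWeight_latticeCondition μ ((m + 1) * (N + 1) - 1) a b
    calc _ = ((ρ (cellLoCorner m (cubeCell m (cellLoCorner ((m + 1) * (N + 1) - 1) a))) : ℝ) *
          ρ (cellLoCorner m (cubeCell m (cellLoCorner ((m + 1) * (N + 1) - 1) b)))) *
          (cubeCellWeight μ _ a * cubeCellWeight μ _ b) := by ring
      _ ≤ ((ρ (cellLoCorner m (cubeCell m (cellLoCorner ((m + 1) * (N + 1) - 1) (a ⊓ b)))) : ℝ) *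
          ρ (cellLoCorner m (cubeCell m (cellLoCorner ((m + 1) * (N + 1) - 1) (a ⊔ b))))) *
          (cubeCellWeight μ _ (a ⊓ b) * cubeCellWeight μ _ (a ⊔ b)) :=
        mul_le_mul hG hwμ (mul_nonneg (cubeCellWeight_nonneg μ _) (cubeCellWeight_nonneg μ _))
          (mul_nonneg (NNReal.coe_nonneg _) (NNReal.coe_nonneg _))
      _ = _ := by ring

/-- **Setwise convergence of the step-tilted measures**: `(ρ_m μ)(B) → (ρ μ)(B)` for every Borel `B` when `ρ` is
continuous (dominated convergence; `Q_d` is compact). [this work] -/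
theorem tendsto_withDensity_step_apply (μ : Measure (Fin d → I)) [IsFiniteMeasure μ] (hρc : Continuous ρ)
    {B : Set (Fin d → I)} (hB : MeasurableSet B) :
    Tendsto (fun m : ℕ => μ.withDensity (fun x => (ρ (cellLoCorner m (cubeCell m x)) : ℝ≥0∞)) B) atTop
      (𝓝 (μ.withDensity (fun x => (ρ x : ℝ≥0∞)) B)) := by
  obtain ⟨x₀, -, hx₀⟩ := isCompact_univ.exists_isMaxOn univ_nonempty hρc.continuousOn
  have hR : ∀ x, ρ x ≤ ρ x₀ := fun x => hx₀ (mem_univ x)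
  simp only [withDensity_apply _ hB]
  refine tendsto_lintegral_of_dominated_convergence (μ := μ.restrict B) (fun _ => (ρ x₀ : ℝ≥0∞))
    (fun m => measurable_step ρ m) (fun m => Eventually.of_forall fun x => ENNReal.coe_le_coe.2 (hR _))
    (by rw [lintegral_const]; exact ENNReal.mul_ne_top ENNReal.coe_ne_top (measure_ne_top _ _))
    (Eventually.of_forall fun x => ?_)
  exact (ENNReal.continuous_coe.tendsto _).comp ((hρc.tendsto x).comp (tendsto_cellLoCorner_cubeCell x))

end Step

/-! ### The tilt theorem -/

/-- **Box-TP₂ is preserved by continuous log-supermodular tilts.**  If `μ` is a finite box-TP₂ measure on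
`Q_d = [0,1]^d` (possibly singular) and `ρ : Q_d → ℝ≥0` is continuous with `ρ x · ρ y ≤ ρ (x ⊓ y) · ρ (x ⊔ y)`, then
the tilted measure `ρ · μ` is box-TP₂. [this work] -/
theorem IsBoxTP2.withDensity_of_continuous (μ : Measure (Fin d → I)) [IsFiniteMeasure μ] (hμ : IsBoxTP2 μ)
    {ρ : (Fin d → I) → ℝ≥0} (hρc : Continuous ρ) (hρ : ∀ x y, ρ x * ρ y ≤ ρ (x ⊓ y) * ρ (x ⊔ y)) :
    IsBoxTP2 (μ.withDensity fun x => (ρ x : ℝ≥0∞)) := by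
  obtain ⟨x₀, -, hx₀⟩ := isCompact_univ.exists_isMaxOn univ_nonempty hρc.continuousOn
  haveI : IsFiniteMeasure (μ.withDensity fun x => (ρ x : ℝ≥0∞)) :=
    isFiniteMeasure_withDensity_of_le μ fun x => ENNReal.coe_le_coe.2 (hx₀ (mem_univ x))
  refine IsBoxTP2.of_limsup_liminf (L := (atTop : Filter ℕ))
    (μs := fun m => μ.withDensity fun x => (ρ (cellLoCorner m (cubeCell m x)) : ℝ≥0∞))
    (Eventually.of_forall fun m => isBoxTP2_withDensity_step ρ μ hμ hρ m) (fun _ => id) (fun _ => id)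
    (fun _ _ _ => rfl) (fun _ _ _ => rfl) (fun _ _ _ => rfl) (fun _ _ _ => rfl) (fun m a b => ?_)
    (fun m a b => ?_) (fun a b => tendsto_const_nhds)
  · exact ((tendsto_withDensity_step_apply ρ μ hρc measurableSet_Icc).liminf_eq).symm.le
  · exact (tendsto_withDensity_step_apply ρ μ hρc measurableSet_Icc).limsup_eq.le

/-- **Gibbs modifications with continuous submodular energy preserve box-TP₂**: for a finite box-TP₂ law `μ` on
`Q_d` and a continuous `H : Q_d → ℝ` with `H (x ⊓ y) + H (x ⊔ y) ≤ H x + H y` (attractive / ferromagnetic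
interaction), the measure `e^{−H} · μ` is box-TP₂ — hence FKG, and Sahi-positive of order `n` given `C_n`
(`SahiBoxTP2Positivity.lean`). [this work] -/
theorem IsBoxTP2.withDensity_exp_of_submodular (μ : Measure (Fin d → I)) [IsFiniteMeasure μ] (hμ : IsBoxTP2 μ)
    {H : (Fin d → I) → ℝ} (hHc : Continuous H) (hH : ∀ x y, H (x ⊓ y) + H (x ⊔ y) ≤ H x + H y) :
    IsBoxTP2 (μ.withDensity fun x => ENNReal.ofReal (Real.exp (-H x))) :=
  hμ.withDensity_of_continuous μ (ρ := fun x => Real.toNNReal (Real.exp (-H x)))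
    (continuous_real_toNNReal.comp (Real.continuous_exp.comp hHc.neg)) fun x y => by
      rw [← Real.toNNReal_mul (Real.exp_pos _).le, ← Real.toNNReal_mul (Real.exp_pos _).le,
        ← Real.exp_add, ← Real.exp_add]
      exact Real.toNNReal_le_toNNReal (Real.exp_le_exp.2 (by linarith [hH x y]))

end Summit.CriticalPhenomena.PercolationContinuityZ3.Theorems.SahiBoxTP2
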